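import Summits.QuantumFields.QCD.Theses.NestedDissectionSea
import Summits.QuantumFields.QCD.Theorems.EarlyCrosserLaw.Negative.CellPositivityDomain
import Summits.QuantumFields.QCD.Theorems.NestedDissectionSeaEarlyCrosserLawCoverReduction

/-!
# Line `kac-rice-hermitian-dos` — skeleton for the crux `EarlyCrosserLaw` (stmt-QuantumFields-13995)
# LEAD RESHAPING (gen 1, seat `prover-line-stmt-QuantumFields-13995-1`, 2026-08-16)

Route `NestedDissectionSea`, crux `Summit.QuantumFields.QCD.Theses.NestedDissectionSea.EarlyCrosserLaw`
(rank 2): `∃` ONE admissible regularisation … `∀ m > M₀ ∃ R` with (a′) WINDOW DILUTION OF EARLY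
CROSSERS (outer phase-quenched probability of "the window box or one of its 16 children has
`det wilsonCell U μ' = 0` at some `μ' ≥ m_f(k)`" is `≤ δ_j`, `Σ_j δ_j ≤ ε`), (b) the LOWER parity pin,
(b″) the UPPER parity pin.  Planner skeleton: `Cruxes/EarlyCrosserLaw/Lines/kac-rice-hermitian-dos.lean`
(crux-plan seat `planner-cruxplan-stmt-QuantumFields-13995-kac-rice-hermitian-d-0`), line card
`Lines/kac-rice-hermitian-dos.md`, idea card `Ideas/kac-rice-hermitian-dos.md`.

## What the lead changed (mechanical; same mathematics, same composition idea)

* `stub_kineticEdge` is DISCHARGED: the route support `KineticEdge` (stmt-QuantumFields-13899) has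
  landed (`Summit.QuantumFields.QCD.Theorems.kineticEdge_proof`), so the Dirichlet kinetic edge is
  imported (`kineticEdge_cell` below), not stubbed.
* The pin stub is now LITERALLY the crux's own clauses (b) ∧ (b″) with their `∃ R` — the statement
  `stub_pinnedLine` already registered on this crux by the `accretive-coarse-jensen` line (lead gen-1
  seat 0) — the same proposition (that text writes the colour group with a local notation `𝔾`, this
  one with the tree abbreviation `SU3`; both elaborate to `Matrix.specialUnitaryGroup (Fin 3) ℂ`), so
  that the TWO-SIDED PARITY PIN is ONE shared node across lines (triage r1-3 P1).  The planner's stronger `Pinned` interface (pins on EVERY `R ≥ R₀`, needed only to take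
  `R := max R₀ R₁`) is gone: instead the cover law is asked AT THE PIN'S OWN `R` (Form-A shape of the
  acj line: `∀ R > 0, LowerPin R → UpperPin R → CoverClause R`), and the composition uses one `R`.
* Every `stub_*` signature is `let`-free, local-definition-free, tree vocabulary only (`SU3`,
  `QCDRegularisation`, `wilsonCell`, `wilsonBox`, `halfCorner`, `halfSides`, `fermionDet`,
  `wilsonDirac`, `fundamentalRep`, `wilsonMeasure` + Mathlib), so the registry (which cuts a
  signature at its first `:=`) records complete statements and a stub worker's file under
  `Theorems/` can state the registered signature literally with this file's imports and `open`s.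
  The `def`s below (`CellQuasimode`, `DilutionClause`, `LowerPin`, `UpperPin`, `CoverClause`,
  `PinnedLine`, `CoverLaw`, `QuasimodeUnionBound`) are documentation and the hypotheses of
  `EarlyCrosserLaw_of`; `earlyCrosserLaw_of_stubs` type-checks by definitional unfolding.
* The cover clause is written per cover point as "parent + Σ over the 16 children" (no
  `Option.elim` packaging), which is the statement a planner would file if `stub_coverLaw` is promoted.

## The line (fixed-resolution Kac–Rice = a mass NET)

* EXACT PART (proved; LANDED as `CoverReduction.quasimode_of_det_eq_zero`, p97227): the bare mass enters the Dirichlet cell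
  additively, `D_c(μ) = D_c(μ') + (μ - μ')·1`, so a kernel vector `w` of `D_c(μ')` is an EXACT
  `|μ - μ'|`-quasimode of `D_c(μ)`: `‖D_c(μ) w‖₂ = |μ - μ'| ‖w‖₂`.  (`Γ₅` unitary: a singular value
  `≤ η` of the cell is an eigenvalue of the Hermitian cell operator `Γ₅ D_c(μ)` in `[-η, η]` — the
  card's Hermitian density of states at zero; no `Γ₅` is typed.)  Hence for ANY finite cover of the
  early interval `[m_f(k), -e_X(s)]` (`e_X(s) = Σ_i (1 - cos(π/s_i))`, the Dirichlet kinetic edge —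
  landed) by intervals `[μc_i ± ηc_i]`, the cover event of (a′) lies in the finite union of the
  QUASIMODE EVENTS at the cover points, over {parent, 16 children}.
* TRANSFER `C⁺` (stub `stub_coverLaw`, load-bearing, the lead's stub): for EVERY admissible
  regularisation there are `b₀, ℓ, C` such that at every `(M₀, m > M₀ + C, R)` where the two-sided
  pin holds, window cells admit finite covers of the early interval whose summed single-event
  phase-quenched probabilities are window-summable — a law for a LINEAR STATISTIC of one-point
  pseudospectral events at finitely many FIXED masses.  On a junk line (`m_f(k) > 0`) the early
  interval is empty (take the empty cover) and the statement is vacuous; by Disproof § 2 the content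
  sits at pinned lines, where it is asked.
* PIN (stub `stub_pinnedLine`, shared): (b) ∧ (b″) with the crux's own `∃ reg … ∃ R` prefix.
* MEASURE (stub `stub_quasimodeUnionBound`, size M — LANDED p96614, imported): the crux's ratio functional is
  monotone-subadditive over finite unions of quasimode events (closed — projection along the compact
  unit sphere — hence Borel; weight continuous and bounded; `integral_mono_of_nonneg` needs no
  measurability of `E`; every junk case gives `0 ≤ Σ`).
* COMPOSITION `EarlyCrosserLaw_of` / `earlyCrosserLaw_of_stubs` (sorry-free, LANDED as Form A in p97227): pin witness `(reg, M₀)`; cover law's `(b₀, ℓ, C)`;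
  `M₀ := M₀ + C`; per mass tuple the pin's `R`; (a′) at that `R` from the cover clause by the
  kinetic edge (children via `halfSides_le` + antitone `cos`), the exact layer and the union bound;
  pins threaded verbatim (monotone in the threshold).

Sorries: exactly the two physics `stub_*` (`stub_pinnedLine`, `stub_coverLaw`); `stub_quasimodeUnionBound` landed (p96614).  Disproof.lean v7 read (no kill; § 2 honoured: the cover law is
conditional on BOTH pins; § 4/`EvenCellSingular`: the U-independent crossing `μ' = -4` of even cells is
inside the early interval only if `m_f(k) ≤ -4`, which the pins exclude near the physical line — but a
proof of the ∀-reg `stub_coverLaw` must itself exclude two-sidedly pinned lines near `-4`, the acj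
lead's "plateau burden", milder here because the pin is two-sided).
-/

noncomputable section

open scoped BigOperators Classical
open Matrix Complex Filter MeasureTheory
open Literature.MathematicalPhysics.QuantumLattice Literature.MathematicalPhysics.QuantumFieldTheory
  Literature.Probability.LatticeModels
open Summit.QuantumFields.QCD.Theses.NestedDissectionSea

namespace Summit.QuantumFields.QCD.Cruxes.EarlyCrosserLaw.KacRiceHermitianDos

-- The colour group is written `SU3` (`Literature.MathematicalPhysics.QuantumFieldTheory.SU3`, the tree
-- abbreviation of `Matrix.specialUnitaryGroup (Fin 3) ℂ`).

/-! ## Vocabulary of the line (documentation + hypotheses of the composition; NOT used in stubs) -/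

/-- **Quasimode event** (pseudospectral / Hermitian small-eigenvalue event): the Dirichlet cell
`wilsonCell U μ x s` has an `ℓ²`-quasimode of tolerance `η`, i.e. a singular value `≤ |η|`;
equivalently the Hermitian cell operator `Γ₅ · wilsonCell U μ x s` has an eigenvalue in `[-|η|, |η|]`.
Sums are explicit so that the norm is Euclidean. -/
def CellQuasimode {N : ℕ} [NeZero N] (U : GaugeConfig 4 N SU3) (μ : ℝ) (x : TorusSite 4 N)
    (s : Fin 4 → ℕ) (η : ℝ) : Prop :=
  ∃ w : {p // wilsonBox x s p} → ℂ, w ≠ 0 ∧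
    ∑ p, ‖(wilsonCell U μ x s *ᵥ w) p‖ ^ 2 ≤ η ^ 2 * ∑ p, ‖w p‖ ^ 2

/-- Clause (a′) of the crux (window dilution of early crossers), as a predicate of the data
`(Nf, reg, b₀, ℓ, m, R)`, `let`-free (same text as the acj reduction's conclusion). -/
def DilutionClause (Nf : ℕ) (reg : QCDRegularisation Nf) (b₀ : ℕ) (ℓ : ℝ) (m : Fin Nf → ℝ)
    (R : ℝ) : Prop :=
  ∀ ε : ℝ, 0 < ε → ∀ᶠ k : ℕ in Filter.atTop, ∀ S : ℕ, R ≤ reg.a k * (2 * S + 1) →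
    ∃ δ : ℕ → ℝ, (∀ j, 0 ≤ δ j) ∧
      ∑ j ∈ Finset.range (Nat.log 2 (⌊ℓ / reg.a k⌋₊ / b₀) + 1), δ j ≤ ε ∧
      ∀ j < Nat.log 2 (⌊ℓ / reg.a k⌋₊ / b₀) + 1, ∀ s : Fin 4 → ℕ,
        (∀ i, b₀ * 2 ^ j ≤ s i ∧ s i < b₀ * 2 ^ (j + 2) ∧ s i ≤ 2 * S + 1 ∧
          (s i : ℝ) * reg.a k ≤ ℓ) →
        ∀ E : GaugeConfig 4 (2 * S + 1) SU3 → Prop,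
          (∀ U, E U → ∃ f : Fin Nf, ∃ μ' : ℝ, reg.mcrit k + reg.a k * m f / reg.Zm k ≤ μ' ∧
            ((wilsonCell U μ' 0 s).det = 0 ∨
              ∃ c : Fin 4 → Bool, (wilsonCell U μ' (halfCorner s c) (halfSides s c)).det = 0)) →
          (∫ U, (if E U then (1 : ℝ) else 0) *
              (∏ f, ‖fermionDet (wilsonDirac (fundamentalRep (Fin 3)) U (reg.mcrit k + reg.a k * m f / reg.Zm k) 1)‖)
            ∂(wilsonMeasure (fundamentalRep (Fin 3)) (reg.β k) : Measure (GaugeConfig 4 (2 * S + 1) SU3))) /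
          (∫ U, (∏ f, ‖fermionDet (wilsonDirac (fundamentalRep (Fin 3)) U (reg.mcrit k + reg.a k * m f / reg.Zm k) 1)‖)
            ∂(wilsonMeasure (fundamentalRep (Fin 3)) (reg.β k) : Measure (GaugeConfig 4 (2 * S + 1) SU3))) ≤ δ j

/-- Clause (b) of the crux (the LOWER parity pin), `let`-free, as a predicate of `(Nf, reg, M₀, m, R)`. -/
def LowerPin (Nf : ℕ) (reg : QCDRegularisation Nf) (M₀ : ℝ) (m : Fin Nf → ℝ) (R : ℝ) : Prop :=
  ∀ M : ℝ, M₀ < M → ∀ᶠ k : ℕ in Filter.atTop, ∀ S : ℕ, R ≤ reg.a k * (2 * S + 1) →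
    (1 / 4 : ℝ) ≤
      (∫ U, (if (fermionDet (wilsonDirac (fundamentalRep (Fin 3)) U
          (reg.mcrit k - reg.a k * M / reg.Zm k) 1)).re < 0 then (1 : ℝ) else 0) *
          (∏ f, ‖fermionDet (wilsonDirac (fundamentalRep (Fin 3)) U (reg.mcrit k + reg.a k * m f / reg.Zm k) 1)‖)
        ∂(wilsonMeasure (fundamentalRep (Fin 3)) (reg.β k) : Measure (GaugeConfig 4 (2 * S + 1) SU3))) /
      (∫ U, (∏ f, ‖fermionDet (wilsonDirac (fundamentalRep (Fin 3)) U (reg.mcrit k + reg.a k * m f / reg.Zm k) 1)‖)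
        ∂(wilsonMeasure (fundamentalRep (Fin 3)) (reg.β k) : Measure (GaugeConfig 4 (2 * S + 1) SU3)))

/-- Clause (b″) of the crux (the UPPER parity pin), `let`-free, as a predicate of `(Nf, reg, M₀, m, R)`. -/
def UpperPin (Nf : ℕ) (reg : QCDRegularisation Nf) (M₀ : ℝ) (m : Fin Nf → ℝ) (R : ℝ) : Prop :=
  ∀ M : ℝ, M₀ < M → ∀ᶠ k : ℕ in Filter.atTop, ∀ S : ℕ, R ≤ reg.a k * (2 * S + 1) →
    reg.a k * (2 * S + 1) ≤ 2 * R →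
    (∫ U, (if (fermionDet (wilsonDirac (fundamentalRep (Fin 3)) U
          (reg.mcrit k + reg.a k * M / reg.Zm k) 1)).re < 0 then (1 : ℝ) else 0) *
          (∏ f, ‖fermionDet (wilsonDirac (fundamentalRep (Fin 3)) U (reg.mcrit k + reg.a k * m f / reg.Zm k) 1)‖)
        ∂(wilsonMeasure (fundamentalRep (Fin 3)) (reg.β k) : Measure (GaugeConfig 4 (2 * S + 1) SU3))) /
      (∫ U, (∏ f, ‖fermionDet (wilsonDirac (fundamentalRep (Fin 3)) U (reg.mcrit k + reg.a k * m f / reg.Zm k) 1)‖)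
        ∂(wilsonMeasure (fundamentalRep (Fin 3)) (reg.β k) : Measure (GaugeConfig 4 (2 * S + 1) SU3))) ≤ (1 / 8 : ℝ)

/-- **Cover clause** (the transferred form `C⁺` of (a′) at data `(Nf, reg, b₀, ℓ, m, R)`): same
`∀ ε ∀ᶠ k ∀ S` prefix, same phase-quenched functional, same window and `δ`-budget as (a′); for every
window cell `s` there is a FINITE COVER `{[μc i - ηc i, μc i + ηc i]}_{i < n}` of the early interval
`[m_f(k), -e_X(s)]` of every flavour (`e_X(s) = Σ_i (1 - cos(π / s_i))`) such that the sum over cover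
points of (probability of the parent's quasimode event + Σ over the 16 children of theirs) is `≤ δ_j`. -/
def CoverClause (Nf : ℕ) (reg : QCDRegularisation Nf) (b₀ : ℕ) (ℓ : ℝ) (m : Fin Nf → ℝ)
    (R : ℝ) : Prop :=
  ∀ ε : ℝ, 0 < ε → ∀ᶠ k : ℕ in Filter.atTop, ∀ S : ℕ, R ≤ reg.a k * (2 * S + 1) →
    ∃ δ : ℕ → ℝ, (∀ j, 0 ≤ δ j) ∧
      ∑ j ∈ Finset.range (Nat.log 2 (⌊ℓ / reg.a k⌋₊ / b₀) + 1), δ j ≤ ε ∧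
      ∀ j < Nat.log 2 (⌊ℓ / reg.a k⌋₊ / b₀) + 1, ∀ s : Fin 4 → ℕ,
        (∀ i, b₀ * 2 ^ j ≤ s i ∧ s i < b₀ * 2 ^ (j + 2) ∧ s i ≤ 2 * S + 1 ∧
          (s i : ℝ) * reg.a k ≤ ℓ) →
        ∃ n : ℕ, ∃ μc ηc : Fin n → ℝ,
          (∀ f : Fin Nf, ∀ t : ℝ, reg.mcrit k + reg.a k * m f / reg.Zm k ≤ t →
            t ≤ -(∑ i, (1 - Real.cos (Real.pi / s i))) → ∃ i : Fin n, |t - μc i| ≤ ηc i) ∧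
          ∑ i : Fin n,
            ((∫ U, (if (∃ w : {p // wilsonBox (0 : TorusSite 4 (2 * S + 1)) s p} → ℂ, w ≠ 0 ∧
                  ∑ p, ‖(wilsonCell U (μc i) 0 s *ᵥ w) p‖ ^ 2 ≤ ηc i ^ 2 * ∑ p, ‖w p‖ ^ 2)
                  then (1 : ℝ) else 0) *
                (∏ f, ‖fermionDet (wilsonDirac (fundamentalRep (Fin 3)) U (reg.mcrit k + reg.a k * m f / reg.Zm k) 1)‖)
              ∂(wilsonMeasure (fundamentalRep (Fin 3)) (reg.β k) : Measure (GaugeConfig 4 (2 * S + 1) SU3))) /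
            (∫ U, (∏ f, ‖fermionDet (wilsonDirac (fundamentalRep (Fin 3)) U (reg.mcrit k + reg.a k * m f / reg.Zm k) 1)‖)
              ∂(wilsonMeasure (fundamentalRep (Fin 3)) (reg.β k) : Measure (GaugeConfig 4 (2 * S + 1) SU3))) +
            ∑ c : Fin 4 → Bool,
              (∫ U, (if (∃ w : {p // wilsonBox (halfCorner s c) (halfSides s c) p} → ℂ, w ≠ 0 ∧
                  ∑ p, ‖(wilsonCell U (μc i) (halfCorner s c) (halfSides s c) *ᵥ w) p‖ ^ 2 ≤
                    ηc i ^ 2 * ∑ p, ‖w p‖ ^ 2) then (1 : ℝ) else 0) *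
                (∏ f, ‖fermionDet (wilsonDirac (fundamentalRep (Fin 3)) U (reg.mcrit k + reg.a k * m f / reg.Zm k) 1)‖)
              ∂(wilsonMeasure (fundamentalRep (Fin 3)) (reg.β k) : Measure (GaugeConfig 4 (2 * S + 1) SU3))) /
            (∫ U, (∏ f, ‖fermionDet (wilsonDirac (fundamentalRep (Fin 3)) U (reg.mcrit k + reg.a k * m f / reg.Zm k) 1)‖)
              ∂(wilsonMeasure (fundamentalRep (Fin 3)) (reg.β k) : Measure (GaugeConfig 4 (2 * S + 1) SU3)))) ≤ δ j

/-- The crux is definitionally its clause decomposition (certifies the `let`-free copies). -/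
theorem earlyCrosserLaw_iff_clauses :
    Summit.QuantumFields.QCD.Theses.NestedDissectionSea.EarlyCrosserLaw ↔
      ∀ Nf : ℕ, (Nf = 2 ∨ Nf = 3) → ∃ reg : QCDRegularisation Nf, reg.HasMassScaling ∧
        (reg.scheme 0 0 0).HasAsymptoticScaling ∧ ∃ M₀ : ℝ, 0 ≤ M₀ ∧ ∃ b₀ : ℕ, 2 ≤ b₀ ∧
        ∃ ℓ : ℝ, 0 < ℓ ∧ ∀ m : Fin Nf → ℝ, (∀ f, M₀ < m f) → ∃ R : ℝ, 0 < R ∧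
          DilutionClause Nf reg b₀ ℓ m R ∧ LowerPin Nf reg M₀ m R ∧ UpperPin Nf reg M₀ m R :=
  Iff.rfl

/-! ## The three named statements (documentation; the stubs below are these, unfolded) -/

/-- **PINNED LINE** — the TWO-SIDED PARITY PIN (b) ∧ (b″) of the crux with its own `∃ reg … ∃ R`
prefix; byte-identical with the registered `stub_pinnedLine` of the `accretive-coarse-jensen` line.
Content: index-carrying real modes of the massless torus Wilson operator concentrate, eventually in
`k`, on a band of lattice width `2 a_k M₀ / Z_m → 0` at `|m_crit(k)|`, with odd parity `≥ 1/4` of the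
time on every physical volume `≥ R⁴` (topological activity surviving the continuum limit with dynamical
phase-quenched Wilson quarks, `χ_t R⁴ ≳ 0.35`) and `≤ 1/8` a distance `M` above the line on volumes
`R⁴ … 16 R⁴` (Mohler–Schaefer's `⟨n_neg⟩ → 0` per fixed physical volume).  Yang–Mills-grade open
physics; by `trivial_without_lowerPin` (Disproof § 2) the only content-bearing clause of the crux as
typed; nearest existing item `SpectralDefectExtinction.WindowExtinction` (neither implies the other). -/
def PinnedLine : Prop :=
  ∀ Nf : ℕ, (Nf = 2 ∨ Nf = 3) → ∃ reg : QCDRegularisation Nf, reg.HasMassScaling ∧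
    (reg.scheme 0 0 0).HasAsymptoticScaling ∧ ∃ M₀ : ℝ, 0 ≤ M₀ ∧
    ∀ m : Fin Nf → ℝ, (∀ f, M₀ < m f) → ∃ R : ℝ, 0 < R ∧
      LowerPin Nf reg M₀ m R ∧ UpperPin Nf reg M₀ m R

/-- **COVER LAW AT PINNED LINES** (the transfer `C⁺`; load-bearing; Form-A shape).  For `N_f ∈ {2,3}`
and EVERY admissible regularisation there are a leaf size `b₀ ≥ 2`, a physical window `ℓ > 0` and a
threshold loss `C ≥ 0` such that at every `(M₀ ≥ 0, m > M₀ + C, R > 0)` where the lower pin (b) and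
the upper pin (b″) hold, the `CoverClause` holds at the same `R`. -/
def CoverLaw : Prop :=
  ∀ Nf : ℕ, (Nf = 2 ∨ Nf = 3) → ∀ reg : QCDRegularisation Nf, reg.HasMassScaling →
    (reg.scheme 0 0 0).HasAsymptoticScaling →
    ∃ b₀ : ℕ, 2 ≤ b₀ ∧ ∃ ℓ : ℝ, 0 < ℓ ∧ ∃ C : ℝ, 0 ≤ C ∧
      ∀ M₀ : ℝ, 0 ≤ M₀ → ∀ m : Fin Nf → ℝ, (∀ f, M₀ + C < m f) → ∀ R : ℝ, 0 < R →
        LowerPin Nf reg M₀ m R → UpperPin Nf reg M₀ m R → CoverClause Nf reg b₀ ℓ m R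

/-- **UNION BOUND** for the crux's ratio functional over finitely many quasimode events. -/
def QuasimodeUnionBound : Prop :=
  ∀ (Nf S : ℕ) (β : ℝ) (mq : Fin Nf → ℝ) (ι : Type) [Fintype ι]
    (x : ι → TorusSite 4 (2 * S + 1)) (sd : ι → Fin 4 → ℕ) (μ η : ι → ℝ)
    (E : GaugeConfig 4 (2 * S + 1) SU3 → Prop),
    (∀ U, E U → ∃ i, CellQuasimode U (μ i) (x i) (sd i) (η i)) →
    (∫ U, (if E U then (1 : ℝ) else 0) *
        (∏ f, ‖fermionDet (wilsonDirac (fundamentalRep (Fin 3)) U (mq f) 1)‖)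
      ∂(wilsonMeasure (fundamentalRep (Fin 3)) β : Measure (GaugeConfig 4 (2 * S + 1) SU3))) /
      (∫ U, (∏ f, ‖fermionDet (wilsonDirac (fundamentalRep (Fin 3)) U (mq f) 1)‖)
        ∂(wilsonMeasure (fundamentalRep (Fin 3)) β : Measure (GaugeConfig 4 (2 * S + 1) SU3))) ≤
    ∑ i, (∫ U, (if CellQuasimode U (μ i) (x i) (sd i) (η i) then (1 : ℝ) else 0) *
        (∏ f, ‖fermionDet (wilsonDirac (fundamentalRep (Fin 3)) U (mq f) 1)‖)
      ∂(wilsonMeasure (fundamentalRep (Fin 3)) β : Measure (GaugeConfig 4 (2 * S + 1) SU3))) /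
      (∫ U, (∏ f, ‖fermionDet (wilsonDirac (fundamentalRep (Fin 3)) U (mq f) 1)‖)
        ∂(wilsonMeasure (fundamentalRep (Fin 3)) β : Measure (GaugeConfig 4 (2 * S + 1) SU3)))

/-! ## The registered stubs (`sorry` lives only here; statements unfolded, tree vocabulary only) -/

/-- **stub 1 — PINNED LINE** (shared two-sided parity pin; YM topology, crux-grade; the same
proposition as the registered `stub_pinnedLine` of line `accretive-coarse-jensen`, colour group spelled
`SU3`): the statement `PinnedLine`, unfolded. [MohlerSchaefer2020 pp. 7–8; EdwardsHellerNarayanan1998; Luscher1982Topology] -/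
theorem stub_pinnedLine :
    ∀ Nf : ℕ, (Nf = 2 ∨ Nf = 3) → ∃ reg : QCDRegularisation Nf, reg.HasMassScaling ∧
      (reg.scheme 0 0 0).HasAsymptoticScaling ∧ ∃ M₀ : ℝ, 0 ≤ M₀ ∧
      ∀ m : Fin Nf → ℝ, (∀ f, M₀ < m f) → ∃ R : ℝ, 0 < R ∧
        (∀ M : ℝ, M₀ < M → ∀ᶠ k : ℕ in Filter.atTop, ∀ S : ℕ, R ≤ reg.a k * (2 * S + 1) →
          (1 / 4 : ℝ) ≤
            (∫ U, (if (fermionDet (wilsonDirac (fundamentalRep (Fin 3)) U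
                (reg.mcrit k - reg.a k * M / reg.Zm k) 1)).re < 0 then (1 : ℝ) else 0) *
                (∏ f, ‖fermionDet (wilsonDirac (fundamentalRep (Fin 3)) U (reg.mcrit k + reg.a k * m f / reg.Zm k) 1)‖)
              ∂(wilsonMeasure (fundamentalRep (Fin 3)) (reg.β k) : Measure (GaugeConfig 4 (2 * S + 1) SU3))) /
            (∫ U, (∏ f, ‖fermionDet (wilsonDirac (fundamentalRep (Fin 3)) U (reg.mcrit k + reg.a k * m f / reg.Zm k) 1)‖)
              ∂(wilsonMeasure (fundamentalRep (Fin 3)) (reg.β k) : Measure (GaugeConfig 4 (2 * S + 1) SU3)))) ∧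
        (∀ M : ℝ, M₀ < M → ∀ᶠ k : ℕ in Filter.atTop, ∀ S : ℕ, R ≤ reg.a k * (2 * S + 1) →
          reg.a k * (2 * S + 1) ≤ 2 * R →
          (∫ U, (if (fermionDet (wilsonDirac (fundamentalRep (Fin 3)) U
                (reg.mcrit k + reg.a k * M / reg.Zm k) 1)).re < 0 then (1 : ℝ) else 0) *
                (∏ f, ‖fermionDet (wilsonDirac (fundamentalRep (Fin 3)) U (reg.mcrit k + reg.a k * m f / reg.Zm k) 1)‖)
              ∂(wilsonMeasure (fundamentalRep (Fin 3)) (reg.β k) : Measure (GaugeConfig 4 (2 * S + 1) SU3))) /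
            (∫ U, (∏ f, ‖fermionDet (wilsonDirac (fundamentalRep (Fin 3)) U (reg.mcrit k + reg.a k * m f / reg.Zm k) 1)‖)
              ∂(wilsonMeasure (fundamentalRep (Fin 3)) (reg.β k) : Measure (GaugeConfig 4 (2 * S + 1) SU3))) ≤ (1 / 8 : ℝ)) := by
  sorry

/-- **stub 2 — COVER LAW AT PINNED LINES** (the transfer `C⁺`; load-bearing; the lead's stub; open
physics of (a′) in Hermitian dress): the statement `CoverLaw`, unfolded.  For EVERY admissible
regularisation there are `b₀ ≥ 2`, `ℓ > 0`, `C ≥ 0` such that at every `(M₀ ≥ 0, m > M₀ + C, R > 0)`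
where (b) and (b″) hold: for every `ε > 0`, eventually in `k`, on every odd torus of physical side
`≥ R`, there is `δ ≥ 0` with `Σ_{j<J} δ_j ≤ ε` such that every window box `s` at scale `j` carries a
finite cover `[μc i ± ηc i]` of `[m_f(k), -e_X(s)]` (all flavours) whose summed quasimode-event
probabilities (parent + 16 children, phase-quenched at the sea masses `m_f(k)`) are `≤ δ_j`.
Why plausible / why it might fail: line card `Lines/kac-rice-hermitian-dos.md` (gap `≳ Z′(μ − m_c)` of
`|Γ₅ D_c(μ)|` above the pinned line vs. Dirichlet WALL quasimodes on cold collars).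
[DelDebbioGiustiLuscherPetronzioTantalo2006; GoltermanShamirSvetitsky2005 p. 2; BachKurig2012 Thm 2.1;
MohlerSchaefer2020] -/
theorem stub_coverLaw :
    ∀ Nf : ℕ, (Nf = 2 ∨ Nf = 3) → ∀ reg : QCDRegularisation Nf, reg.HasMassScaling →
      (reg.scheme 0 0 0).HasAsymptoticScaling →
      ∃ b₀ : ℕ, 2 ≤ b₀ ∧ ∃ ℓ : ℝ, 0 < ℓ ∧ ∃ C : ℝ, 0 ≤ C ∧
      ∀ M₀ : ℝ, 0 ≤ M₀ → ∀ m : Fin Nf → ℝ, (∀ f, M₀ + C < m f) → ∀ R : ℝ, 0 < R →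
        (∀ M : ℝ, M₀ < M → ∀ᶠ k : ℕ in Filter.atTop, ∀ S : ℕ, R ≤ reg.a k * (2 * S + 1) →
          (1 / 4 : ℝ) ≤
            (∫ U, (if (fermionDet (wilsonDirac (fundamentalRep (Fin 3)) U
                (reg.mcrit k - reg.a k * M / reg.Zm k) 1)).re < 0 then (1 : ℝ) else 0) *
                (∏ f, ‖fermionDet (wilsonDirac (fundamentalRep (Fin 3)) U (reg.mcrit k + reg.a k * m f / reg.Zm k) 1)‖)
              ∂(wilsonMeasure (fundamentalRep (Fin 3)) (reg.β k) : Measure (GaugeConfig 4 (2 * S + 1) SU3))) /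
            (∫ U, (∏ f, ‖fermionDet (wilsonDirac (fundamentalRep (Fin 3)) U (reg.mcrit k + reg.a k * m f / reg.Zm k) 1)‖)
              ∂(wilsonMeasure (fundamentalRep (Fin 3)) (reg.β k) : Measure (GaugeConfig 4 (2 * S + 1) SU3)))) →
        (∀ M : ℝ, M₀ < M → ∀ᶠ k : ℕ in Filter.atTop, ∀ S : ℕ, R ≤ reg.a k * (2 * S + 1) →
          reg.a k * (2 * S + 1) ≤ 2 * R →
          (∫ U, (if (fermionDet (wilsonDirac (fundamentalRep (Fin 3)) U
                (reg.mcrit k + reg.a k * M / reg.Zm k) 1)).re < 0 then (1 : ℝ) else 0) *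
                (∏ f, ‖fermionDet (wilsonDirac (fundamentalRep (Fin 3)) U (reg.mcrit k + reg.a k * m f / reg.Zm k) 1)‖)
              ∂(wilsonMeasure (fundamentalRep (Fin 3)) (reg.β k) : Measure (GaugeConfig 4 (2 * S + 1) SU3))) /
            (∫ U, (∏ f, ‖fermionDet (wilsonDirac (fundamentalRep (Fin 3)) U (reg.mcrit k + reg.a k * m f / reg.Zm k) 1)‖)
              ∂(wilsonMeasure (fundamentalRep (Fin 3)) (reg.β k) : Measure (GaugeConfig 4 (2 * S + 1) SU3))) ≤ (1 / 8 : ℝ)) →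
        ∀ ε : ℝ, 0 < ε → ∀ᶠ k : ℕ in Filter.atTop, ∀ S : ℕ, R ≤ reg.a k * (2 * S + 1) →
          ∃ δ : ℕ → ℝ, (∀ j, 0 ≤ δ j) ∧
            ∑ j ∈ Finset.range (Nat.log 2 (⌊ℓ / reg.a k⌋₊ / b₀) + 1), δ j ≤ ε ∧
            ∀ j < Nat.log 2 (⌊ℓ / reg.a k⌋₊ / b₀) + 1, ∀ s : Fin 4 → ℕ,
              (∀ i, b₀ * 2 ^ j ≤ s i ∧ s i < b₀ * 2 ^ (j + 2) ∧ s i ≤ 2 * S + 1 ∧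
                (s i : ℝ) * reg.a k ≤ ℓ) →
              ∃ n : ℕ, ∃ μc ηc : Fin n → ℝ,
                (∀ f : Fin Nf, ∀ t : ℝ, reg.mcrit k + reg.a k * m f / reg.Zm k ≤ t →
                  t ≤ -(∑ i, (1 - Real.cos (Real.pi / s i))) → ∃ i : Fin n, |t - μc i| ≤ ηc i) ∧
                ∑ i : Fin n,
                  ((∫ U, (if (∃ w : {p // wilsonBox (0 : TorusSite 4 (2 * S + 1)) s p} → ℂ, w ≠ 0 ∧
                        ∑ p, ‖(wilsonCell U (μc i) 0 s *ᵥ w) p‖ ^ 2 ≤ ηc i ^ 2 * ∑ p, ‖w p‖ ^ 2)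
                        then (1 : ℝ) else 0) *
                      (∏ f, ‖fermionDet (wilsonDirac (fundamentalRep (Fin 3)) U (reg.mcrit k + reg.a k * m f / reg.Zm k) 1)‖)
                    ∂(wilsonMeasure (fundamentalRep (Fin 3)) (reg.β k) : Measure (GaugeConfig 4 (2 * S + 1) SU3))) /
                  (∫ U, (∏ f, ‖fermionDet (wilsonDirac (fundamentalRep (Fin 3)) U (reg.mcrit k + reg.a k * m f / reg.Zm k) 1)‖)
                    ∂(wilsonMeasure (fundamentalRep (Fin 3)) (reg.β k) : Measure (GaugeConfig 4 (2 * S + 1) SU3))) +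
                  ∑ c : Fin 4 → Bool,
                    (∫ U, (if (∃ w : {p // wilsonBox (halfCorner s c) (halfSides s c) p} → ℂ, w ≠ 0 ∧
                        ∑ p, ‖(wilsonCell U (μc i) (halfCorner s c) (halfSides s c) *ᵥ w) p‖ ^ 2 ≤
                          ηc i ^ 2 * ∑ p, ‖w p‖ ^ 2) then (1 : ℝ) else 0) *
                      (∏ f, ‖fermionDet (wilsonDirac (fundamentalRep (Fin 3)) U (reg.mcrit k + reg.a k * m f / reg.Zm k) 1)‖)
                    ∂(wilsonMeasure (fundamentalRep (Fin 3)) (reg.β k) : Measure (GaugeConfig 4 (2 * S + 1) SU3))) /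
                  (∫ U, (∏ f, ‖fermionDet (wilsonDirac (fundamentalRep (Fin 3)) U (reg.mcrit k + reg.a k * m f / reg.Zm k) 1)‖)
                    ∂(wilsonMeasure (fundamentalRep (Fin 3)) (reg.β k) : Measure (GaugeConfig 4 (2 * S + 1) SU3)))) ≤ δ j := by
  sorry

/-! `stub_quasimodeUnionBound` (stub 3 — union bound for the phase-quenched functional over quasimode
events) has LANDED (`Theorems/NestedDissectionSeaEarlyCrosserLawStubQuasimodeUnionBound.lean`, p96614, wave 1 of
this lead) and so has the whole deterministic layer + composition
(`Theorems/NestedDissectionSeaEarlyCrosserLawCoverReduction.lean`, p97227: exact Kac–Rice layer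
`CoverReduction.quasimode_of_det_eq_zero`, kinetic edge `CoverReduction.kineticEdge_cell` from the landed
`kineticEdge_proof`, `dilution_of_coverLaw` = cover clause ⇒ (a′), `EarlyCrosserLaw_of_pinnedLine_of_coverLaw` =
Form A, `EarlyCrosserLaw_of_pinnedCover` = Form B); both are imported above.  The statement
`QuasimodeUnionBound` is the landed stub's type, unfolded. -/

/-- The pins are monotone in their threshold `M₀` (documentation of the re-basing `M₀ ↦ M₀ + C`). -/
theorem lowerPin_mono {Nf : ℕ} {reg : QCDRegularisation Nf} {M₀ M₁ : ℝ} {m : Fin Nf → ℝ} {R : ℝ}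
    (hM : M₀ ≤ M₁) (h : LowerPin Nf reg M₀ m R) : LowerPin Nf reg M₁ m R :=
  fun M hM₁ => h M (lt_of_le_of_lt hM hM₁)

/-- The pins are monotone in their threshold `M₀`. -/
theorem upperPin_mono {Nf : ℕ} {reg : QCDRegularisation Nf} {M₀ M₁ : ℝ} {m : Fin Nf → ℝ} {R : ℝ}
    (hM : M₀ ≤ M₁) (h : UpperPin Nf reg M₀ m R) : UpperPin Nf reg M₁ m R :=
  fun M hM₁ => h M (lt_of_le_of_lt hM hM₁)

/-! ## The composition -/

/-- **COMPOSITION (Form A, by the LANDED reduction).**  `PinnedLine → CoverLaw → EarlyCrosserLaw`: this is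
`EarlyCrosserLaw_of_pinnedLine_of_coverLaw` (p97227) read through the `def`s (definitional unfolding; the landed
union bound and kinetic edge are used inside it). -/
theorem EarlyCrosserLaw_of (hPin : PinnedLine) (hCov : CoverLaw) :
    Summit.QuantumFields.QCD.Theses.NestedDissectionSea.EarlyCrosserLaw :=
  EarlyCrosserLaw_of_pinnedLine_of_coverLaw hPin hCov

/-- The registered stubs literally fit the landed composition: the crux BY NAME from the two physics stubs
(this declaration inherits their `sorry`s and nothing else). -/
theorem earlyCrosserLaw_of_stubs :
    Summit.QuantumFields.QCD.Theses.NestedDissectionSea.EarlyCrosserLaw :=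
  EarlyCrosserLaw_of_pinnedLine_of_coverLaw stub_pinnedLine stub_coverLaw

end Summit.QuantumFields.QCD.Cruxes.EarlyCrosserLaw.KacRiceHermitianDos
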